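import Mathlib.Geometry.Manifold.Instances.Sphere
import Mathlib.Analysis.Calculus.BumpFunction.InnerProduct
import Mathlib.Analysis.InnerProductSpace.Calculus
import Literature.Topology.FourManifolds.IntersectionLatticeOrientationProofs
import Literature.AlgebraicTopology.SingularHomology.FundamentalClassProofs
import Literature.AlgebraicTopology.SingularHomology.FundamentalClassExistence
import Literature.AlgebraicTopology.SingularHomology.BoundaryClassNaturality
import HarnessLib

/-!
# The smooth pinch map `N → Sⁿ` of a chart ball, and its effect on fundamental classes

G. E. Bredon, *Topology and Geometry*, GTM 139 (1993), VI.7 (Thm. 7.15 ff.: the orientation class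
and local degrees), II.11 and V.6 ("collapsing the complement of a disk", the degree-one map
`M → Sⁿ`); J. Milnor, *Topology from the Differentiable Viewpoint* (1965), §4–§5 (a smooth map
which is an orientation-preserving diffeomorphism of a ball onto `Sⁿ ∖ {pole}` and constant
elsewhere has degree `1`); A. Hatcher, *Algebraic Topology* (2002), §3.3 Thm. 3.26 and Exercise 3.3.7
("for a closed connected oriented `n`-manifold there is a degree `1` map `M → Sⁿ`", by collapsing
the complement of a coordinate ball).

For a `C^∞` manifold `N` charted on `ℝⁿ` and a partial homeomorphism `c : N ⇀ ℝⁿ`, smooth on its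
source, whose target contains the closed unit ball, this file constructs

* `modelPinch n : ℝⁿ → Sⁿ` — the smooth model collapse: the inverse stereographic projection of
  `y / ψ(y)` on the open unit ball (`ψ` a smooth bump, `≡ 1` on the ball of radius `½`, supported in
  the open unit ball) and the pole outside; it is `C^∞` on all of `ℝⁿ` (`contMDiff_modelPinch`),
  agrees with the inverse stereographic chart near `0` (`modelPinch_eq_symm`) and takes the value
  `basePoint n = σ⁻¹(0)` exactly at `0` (`modelPinch_eq_basePoint_iff`);
* `pinch c : N → Sⁿ` — `modelPinch ∘ c` on the chart source, the pole elsewhere: a `C^∞` map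
  (`contMDiff_pinch`) with `pinch c ⁻¹ {basePoint} = {c⁻¹ 0}` (`pinch_eq_basePoint_iff`);
* `map_pinch_localClass` — **the pinch map carries the chart-transported reference generator of
  `Hₙ(N | p; ℤ)` (`p = c⁻¹ 0`) to a FIXED generator `pinchLocalClass n ∈ Hₙ(Sⁿ | basePoint; ℤ)`**,
  the one transported from the reference generator of `Hₙ(ℝⁿ | 0; ℤ)` along the stereographic chart;
* `toLocal_map_pinch_fundamentalClass`, **`map_pinch_fundamentalClass_eq`** — hence, for a closed
  `N` with a `ℤ`-orientation `μ` whose local class at `p` is the `c`-transport of the reference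
  generator, `(pinch c)_* [N]_μ ∈ Hₙ(Sⁿ; ℤ)` restricts at the base point to that fixed generator, and
  **any two such push-forwards (from any two manifolds of the same dimension `n ≥ 1`) coincide**
  (`Hₙ(Sⁿ) → Hₙ(Sⁿ | pt)` is injective on the closed connected `Sⁿ`, Hatcher Thm. 3.26(b)).

This is the homological half of "a positively oriented chart ball gives a degree-one map to the
sphere"; the de Rham half (comparison of integration signs) is built on it in
`Literature/Geometry/Manifold/DeRhamOrientationSign.lean`.  Everything is proved; no named facts.

## References

* [Bredon1993] G. E. Bredon, Topology and Geometry, GTM 139, Springer 1993, VI.7, V.6.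
* [MilnorTDV1965] J. Milnor, Topology from the Differentiable Viewpoint, 1965, §4–§5.
* [HatcherAT2002] A. Hatcher, Algebraic Topology, CUP 2002, §3.3 Thm. 3.26, Exercise 3.3.7.
-/

noncomputable section

open scoped Manifold ContDiff Topology
open Set Metric Module Function
open Literature.AlgebraicTopology.SingularHomology
open Literature.Topology.FourManifolds Literature.Topology.FourManifolds.HomologicalOrientationOfSmooth

namespace Literature.Geometry.Manifold

/-- `dim ℝⁿ⁺¹ = n + 1`, as a `Fact` (the instance Mathlib's sphere charts are keyed on). [folklore] -/
instance factFinrankEuclideanSucc (n : ℕ) : Fact (finrank ℝ (EuclideanSpace ℝ (Fin (n + 1))) = n + 1) :=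
  ⟨finrank_euclideanSpace_fin⟩

namespace SmoothPinch

variable (n : ℕ)

/-! ### The model collapse `ℝⁿ → Sⁿ` -/

/-- The pole `e_last ∈ Sⁿ ⊂ ℝⁿ⁺¹` onto which the complement of the ball is collapsed. [folklore] -/
def pole : sphere (0 : EuclideanSpace ℝ (Fin (n + 1))) 1 :=
  ⟨EuclideanSpace.single (Fin.last n) 1, by simp [PiLp.norm_single]⟩

/-- The stereographic chart of `Sⁿ` from the pole (source `Sⁿ ∖ {pole}`, target `ℝⁿ`). [folklore] -/
def stereo : OpenPartialHomeomorph (sphere (0 : EuclideanSpace ℝ (Fin (n + 1))) 1) (EuclideanSpace ℝ (Fin n)) :=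
  stereographic' n (pole n)

/-- The stereographic chart is defined off the pole. [folklore] -/
theorem stereo_source : (stereo n).source = {pole n}ᶜ := stereographic'_source (pole n)

/-- The stereographic chart is onto `ℝⁿ`. [folklore] -/
theorem stereo_target : (stereo n).target = univ := stereographic'_target (pole n)

/-- The stereographic chart belongs to the atlas of `Sⁿ`. [folklore] -/
theorem stereo_mem_atlas : stereo n ∈ atlas (EuclideanSpace ℝ (Fin n)) (sphere (0 : EuclideanSpace ℝ (Fin (n + 1))) 1) :=
  ⟨pole n, rfl⟩

/-- The base point `σ⁻¹(0) ∈ Sⁿ` (the antipode of the pole). [folklore] -/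
def basePoint : sphere (0 : EuclideanSpace ℝ (Fin (n + 1))) 1 := (stereo n).symm 0

/-- The base point lies in the source of the stereographic chart. [folklore] -/
theorem basePoint_mem_source : basePoint n ∈ (stereo n).source :=
  (stereo n).map_target (by rw [stereo_target]; exact mem_univ _)

/-- `σ(σ⁻¹ 0) = 0`. [folklore] -/
theorem stereo_basePoint : stereo n (basePoint n) = 0 :=
  (stereo n).right_inv (by rw [stereo_target]; exact mem_univ _)

/-- `σ⁻¹` misses the pole. [folklore] -/
theorem symm_ne_pole (y : EuclideanSpace ℝ (Fin n)) : (stereo n).symm y ≠ pole n := by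
  have h : (stereo n).symm y ∈ (stereo n).source := (stereo n).map_target (by rw [stereo_target]; exact mem_univ _)
  rw [stereo_source] at h
  exact h

/-- The base point is not the pole. [folklore] -/
theorem basePoint_ne_pole : basePoint n ≠ pole n := symm_ne_pole n 0

/-- The bump `ψ`: smooth, `0 ≤ ψ ≤ 1`, `ψ ≡ 1` on the closed ball of radius `½`, `supp ψ = B(0, 1)`.
[folklore] -/
def bump : ContDiffBump (0 : EuclideanSpace ℝ (Fin n)) := ⟨1 / 2, 1, by norm_num, by norm_num⟩

/-- Inner radius of the bump. [folklore] -/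
theorem bump_rIn : (bump n).rIn = 1 / 2 := rfl

/-- Outer radius of the bump. [folklore] -/
theorem bump_rOut : (bump n).rOut = 1 := rfl

/-- The bump is positive on the open unit ball. [folklore] -/
theorem bump_pos {y : EuclideanSpace ℝ (Fin n)} (hy : ‖y‖ < 1) : 0 < bump n y :=
  (bump n).pos_of_mem_ball (by rwa [mem_ball_zero_iff, bump_rOut])

/-- The bump is `1` on the ball of radius `½`. [folklore] -/
theorem bump_eq_one {y : EuclideanSpace ℝ (Fin n)} (hy : ‖y‖ ≤ 1 / 2) : bump n y = 1 :=
  (bump n).one_of_mem_closedBall (by rwa [mem_closedBall_zero_iff, bump_rIn])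

/-- The bump vanishes off the open unit ball. [folklore] -/
theorem bump_eq_zero {y : EuclideanSpace ℝ (Fin n)} (hy : 1 ≤ ‖y‖) : bump n y = 0 :=
  (bump n).zero_of_le_dist (by rwa [dist_zero_right, bump_rOut])

/-- The linear isometry `(ℝ · pole)ᗮ ≃ ℝⁿ` used by Mathlib's `stereographic'`. [folklore] -/
def frame : (ℝ ∙ ((pole n : sphere (0 : EuclideanSpace ℝ (Fin (n + 1))) 1) : EuclideanSpace ℝ (Fin (n + 1))))ᗮ ≃ₗᵢ[ℝ]
    EuclideanSpace ℝ (Fin n) :=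
  (OrthonormalBasis.fromOrthogonalSpanSingleton n (ne_zero_of_mem_unit_sphere (pole n))).repr

/-- Mathlib's formula for the inverse stereographic chart, through `frame`. [folklore] -/
theorem coe_stereo_symm (x : EuclideanSpace ℝ (Fin n)) :
    ((stereo n).symm x : EuclideanSpace ℝ (Fin (n + 1))) =
      (‖((frame n).symm x : EuclideanSpace ℝ (Fin (n + 1)))‖ ^ 2 + 4)⁻¹ • (4 : ℝ) •
          ((frame n).symm x : EuclideanSpace ℝ (Fin (n + 1))) +
        (‖((frame n).symm x : EuclideanSpace ℝ (Fin (n + 1)))‖ ^ 2 + 4)⁻¹ •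
          (‖((frame n).symm x : EuclideanSpace ℝ (Fin (n + 1)))‖ ^ 2 - 4) •
            ((pole n : sphere (0 : EuclideanSpace ℝ (Fin (n + 1))) 1) : EuclideanSpace ℝ (Fin (n + 1))) :=
  stereographic'_symm_apply (pole n) x

/-- `frame` is an isometry. [folklore] -/
theorem norm_frame_symm (x : EuclideanSpace ℝ (Fin n)) :
    ‖((frame n).symm x : EuclideanSpace ℝ (Fin (n + 1)))‖ = ‖x‖ := by
  rw [Submodule.norm_coe, LinearIsometryEquiv.norm_map]

/-- **The model collapse as a map to `ℝⁿ⁺¹`**: `y ↦ σ⁻¹(y / ψ(y))` written over the common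
denominator `‖y‖² + 4ψ(y)²`, a formula that is smooth on all of `ℝⁿ` and equals the pole where
`ψ = 0`. [cite: MilnorTDV1965, §4] -/
def modelPinchAux (y : EuclideanSpace ℝ (Fin n)) : EuclideanSpace ℝ (Fin (n + 1)) :=
  (‖y‖ ^ 2 + 4 * bump n y ^ 2)⁻¹ •
    ((4 * bump n y) • ((frame n).symm y : EuclideanSpace ℝ (Fin (n + 1))) +
      (‖y‖ ^ 2 - 4 * bump n y ^ 2) • ((pole n : sphere (0 : EuclideanSpace ℝ (Fin (n + 1))) 1) : EuclideanSpace ℝ (Fin (n + 1))))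

/-- The common denominator `‖y‖² + 4ψ(y)²` is positive. [folklore] -/
theorem denom_pos (y : EuclideanSpace ℝ (Fin n)) : 0 < ‖y‖ ^ 2 + 4 * bump n y ^ 2 := by
  by_cases hy : ‖y‖ < 1
  · have := bump_pos n hy
    positivity
  · push Not at hy
    have : 0 < ‖y‖ := lt_of_lt_of_le one_pos hy
    positivity

/-- Where `ψ > 0`, the formula is the inverse stereographic chart at `y / ψ(y)`. [folklore] -/
theorem modelPinchAux_eq_of_pos {y : EuclideanSpace ℝ (Fin n)} (hy : 0 < bump n y) :
    modelPinchAux n y = ((stereo n).symm ((bump n y)⁻¹ • y) : EuclideanSpace ℝ (Fin (n + 1))) := by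
  set t := bump n y with ht
  have ht0 : t ≠ 0 := hy.ne'
  rw [coe_stereo_symm, map_smul, Submodule.coe_smul, norm_smul, norm_frame_symm, norm_inv, Real.norm_eq_abs,
    abs_of_pos hy, modelPinchAux]
  have hden : ((t⁻¹ * ‖y‖) ^ 2 + 4) = t⁻¹ ^ 2 * (‖y‖ ^ 2 + 4 * t ^ 2) := by
    field_simp
  rw [hden, mul_inv, smul_add, ← ht]
  have hd0 : ‖y‖ ^ 2 + 4 * t ^ 2 ≠ 0 := (denom_pos n y).ne'
  congr 1
  · rw [smul_smul, smul_smul, smul_smul]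
    congr 1
    field_simp
  · rw [smul_smul, smul_smul]
    congr 1
    field_simp

/-- Where `ψ = 0` (off the open unit ball), the formula is the pole. [folklore] -/
theorem modelPinchAux_eq_pole {y : EuclideanSpace ℝ (Fin n)} (hy : 1 ≤ ‖y‖) :
    modelPinchAux n y = ((pole n : sphere (0 : EuclideanSpace ℝ (Fin (n + 1))) 1) : EuclideanSpace ℝ (Fin (n + 1))) := by
  have h0 : bump n y = 0 := bump_eq_zero n hy
  have hy0 : ‖y‖ ^ 2 ≠ 0 := by positivity
  rw [modelPinchAux, h0]
  simp only [mul_zero, zero_smul, zero_add, sub_zero, add_zero, ne_eq, OfNat.ofNat_ne_zero,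
    not_false_eq_true, zero_pow, smul_smul, inv_mul_cancel₀ hy0, one_smul]

/-- The formula lands in the unit sphere. [folklore] -/
theorem modelPinchAux_mem (y : EuclideanSpace ℝ (Fin n)) :
    modelPinchAux n y ∈ sphere (0 : EuclideanSpace ℝ (Fin (n + 1))) 1 := by
  by_cases hy : ‖y‖ < 1
  · rw [modelPinchAux_eq_of_pos n (bump_pos n hy)]
    exact Subtype.mem _
  · push Not at hy
    rw [modelPinchAux_eq_pole n hy]
    exact Subtype.mem _

/-- The formula is `C^∞` on `ℝⁿ`. [folklore] -/
theorem contDiff_modelPinchAux : ContDiff ℝ ∞ (modelPinchAux n) := by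
  have hb : ContDiff ℝ ∞ (bump n : EuclideanSpace ℝ (Fin n) → ℝ) := (bump n).contDiff
  have hn2 : ContDiff ℝ ∞ fun y : EuclideanSpace ℝ (Fin n) ↦ ‖y‖ ^ 2 := contDiff_norm_sq ℝ
  have hden : ContDiff ℝ ∞ fun y : EuclideanSpace ℝ (Fin n) ↦ (‖y‖ ^ 2 + 4 * bump n y ^ 2)⁻¹ :=
    (hn2.add (contDiff_const.mul (hb.pow 2))).inv fun y ↦ (denom_pos n y).ne'
  have hfr : ContDiff ℝ ∞ fun y : EuclideanSpace ℝ (Fin n) ↦ ((frame n).symm y : EuclideanSpace ℝ (Fin (n + 1))) :=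
    ((Submodule.subtypeL _).contDiff).comp (frame n).symm.toContinuousLinearEquiv.contDiff
  unfold modelPinchAux
  exact hden.smul (((contDiff_const.mul hb).smul hfr).add ((hn2.sub (contDiff_const.mul (hb.pow 2))).smul contDiff_const))

/-- **The model collapse `ℝⁿ → Sⁿ`.** [cite: MilnorTDV1965, §4] -/
def modelPinch : EuclideanSpace ℝ (Fin n) → sphere (0 : EuclideanSpace ℝ (Fin (n + 1))) 1 :=
  codRestrict (modelPinchAux n) _ (modelPinchAux_mem n)

/-- **The model collapse is `C^∞`.** [cite: MilnorTDV1965, §4] -/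
theorem contMDiff_modelPinch : ContMDiff (𝓡 n) (𝓡 n) ∞ (modelPinch n) :=
  (contDiff_modelPinchAux n).contMDiff.codRestrict_sphere (modelPinchAux_mem n)

/-- The model collapse is continuous. [folklore] -/
theorem continuous_modelPinch : Continuous (modelPinch n) := (contMDiff_modelPinch n).continuous

/-- On the open unit ball the collapse is `σ⁻¹(y / ψ(y))`. [folklore] -/
theorem modelPinch_eq_symm_smul {y : EuclideanSpace ℝ (Fin n)} (hy : ‖y‖ < 1) :
    modelPinch n y = (stereo n).symm ((bump n y)⁻¹ • y) :=
  Subtype.ext (modelPinchAux_eq_of_pos n (bump_pos n hy))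

/-- **Near the origin (`‖y‖ ≤ ½`) the collapse IS the inverse stereographic chart.** [folklore] -/
theorem modelPinch_eq_symm {y : EuclideanSpace ℝ (Fin n)} (hy : ‖y‖ ≤ 1 / 2) : modelPinch n y = (stereo n).symm y := by
  rw [modelPinch_eq_symm_smul n (lt_of_le_of_lt hy (by norm_num)), bump_eq_one n hy, inv_one, one_smul]

/-- Off the open unit ball the collapse is the pole. [folklore] -/
theorem modelPinch_eq_pole {y : EuclideanSpace ℝ (Fin n)} (hy : 1 ≤ ‖y‖) : modelPinch n y = pole n :=
  Subtype.ext (modelPinchAux_eq_pole n hy)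

/-- The model collapse at the origin is the base point. [folklore] -/
theorem modelPinch_zero : modelPinch n 0 = basePoint n := by
  rw [modelPinch_eq_symm n (by rw [norm_zero]; norm_num)]
  rfl

/-- **The collapse takes the value `σ⁻¹(0)` only at `0`.** [folklore] -/
theorem modelPinch_eq_basePoint_iff {y : EuclideanSpace ℝ (Fin n)} : modelPinch n y = basePoint n ↔ y = 0 := by
  refine ⟨fun h ↦ ?_, fun h ↦ by rw [h, modelPinch_zero]⟩
  by_cases hy : ‖y‖ < 1
  · rw [modelPinch_eq_symm_smul n hy, basePoint] at h
    have hinj := (stereo n).symm.injOn (by rw [(stereo n).symm_source, stereo_target]; exact mem_univ _)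
      (by rw [(stereo n).symm_source, stereo_target]; exact mem_univ _) h
    rcases smul_eq_zero.1 hinj with h0 | h0
    · exact absurd h0 (inv_ne_zero (bump_pos n hy).ne')
    · exact h0
  · push Not at hy
    rw [modelPinch_eq_pole n hy] at h
    exact absurd h.symm (basePoint_ne_pole n)


/-! ### The pinch map of a chart ball -/

section Pinch

variable {n}
variable {N : Type} [TopologicalSpace N] (c : OpenPartialHomeomorph N (EuclideanSpace ℝ (Fin n)))

open Classical in
/-- **The pinch map of the chart `c`**: the model collapse of `c` on the chart source, the pole
elsewhere — a continuous (indeed `C^∞`, `contMDiff_pinch`) map `N → Sⁿ` which is the inverse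
stereographic chart composed with `c` near `c⁻¹(0)` and constant off `c⁻¹(B(0, 1))`.
[cite: Bredon1993, V.6] [cite: HatcherAT2002, Exercise 3.3.7] -/
def pinch (x : N) : sphere (0 : EuclideanSpace ℝ (Fin (n + 1))) 1 :=
  if x ∈ c.source then modelPinch n (c x) else pole n

/-- The pinch map on the chart source. [folklore] -/
theorem pinch_of_mem {x : N} (hx : x ∈ c.source) : pinch c x = modelPinch n (c x) := if_pos hx

/-- The pinch map off the chart source. [folklore] -/
theorem pinch_of_not_mem {x : N} (hx : x ∉ c.source) : pinch c x = pole n := if_neg hx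

/-- Near `c⁻¹(0)` the pinch map is `σ⁻¹ ∘ c`. [folklore] -/
theorem pinch_eq_symm {x : N} (hx : x ∈ c.source) (hcx : ‖c x‖ ≤ 1 / 2) : pinch c x = (stereo n).symm (c x) := by
  rw [pinch_of_mem c hx, modelPinch_eq_symm n hcx]

/-- The pinch map is the pole off `c⁻¹(B(0, 1))`. [folklore] -/
theorem pinch_eq_pole {x : N} (hx : x ∈ c.source) (hcx : 1 ≤ ‖c x‖) : pinch c x = pole n := by
  rw [pinch_of_mem c hx, modelPinch_eq_pole n hcx]

/-- **The fibre of the base point is the centre**: `pinch c x = σ⁻¹(0) ↔ x ∈ c.source ∧ c x = 0`.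
[folklore] -/
theorem pinch_eq_basePoint_iff {x : N} : pinch c x = basePoint n ↔ x ∈ c.source ∧ c x = 0 := by
  by_cases hx : x ∈ c.source
  · rw [pinch_of_mem c hx, modelPinch_eq_basePoint_iff]
    exact ⟨fun h ↦ ⟨hx, h⟩, fun h ↦ h.2⟩
  · rw [pinch_of_not_mem c hx]
    exact ⟨fun h ↦ absurd h.symm (basePoint_ne_pole n), fun h ↦ absurd h.1 hx⟩

variable (h0 : (0 : EuclideanSpace ℝ (Fin n)) ∈ c.target)

include h0 in
/-- With `0 ∈ c.target`: `pinch c x = σ⁻¹(0) ↔ x = c⁻¹(0)`. [folklore] -/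
theorem pinch_eq_basePoint_iff' {x : N} : pinch c x = basePoint n ↔ x = c.symm 0 := by
  rw [pinch_eq_basePoint_iff]
  constructor
  · rintro ⟨hx, hcx⟩
    rw [← hcx, c.left_inv hx]
  · rintro rfl
    exact ⟨c.map_target h0, c.right_inv h0⟩

include h0 in
/-- The pinch map at the centre. [folklore] -/
theorem pinch_symm_zero : pinch c (c.symm 0) = basePoint n := (pinch_eq_basePoint_iff' c h0).2 rfl

include h0 in
/-- The pinch map is a map of pairs `(N, N ∖ c⁻¹(0)) → (Sⁿ, Sⁿ ∖ σ⁻¹(0))`. [folklore] -/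
theorem mapsTo_pinch : MapsTo (pinch c) ({c.symm 0}ᶜ : Set N) ({basePoint n}ᶜ : Set _) := fun _ hx h ↦
  hx ((pinch_eq_basePoint_iff' c h0).1 h)

variable [ChartedSpace (EuclideanSpace ℝ (Fin n)) N]

/-- **The pinch map is `C^∞`** when `c` is smooth on its source and its target contains the closed
unit ball (`N` Hausdorff): on the chart source it is `modelPinch ∘ c`; off the compact set
`c⁻¹(closed unit ball)` it is constant. [cite: MilnorTDV1965, §4] [cite: Bredon1993, V.6] -/
theorem contMDiff_pinch [T2Space N] [IsManifold (𝓡 n) ∞ N] (hcs : ContMDiffOn (𝓡 n) (𝓡 n) ∞ c c.source)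
    (hc1 : closedBall (0 : EuclideanSpace ℝ (Fin n)) 1 ⊆ c.target) : ContMDiff (𝓡 n) (𝓡 n) ∞ (pinch c) := by
  intro x
  by_cases hx : x ∈ c.source
  · have h1 : ContMDiffAt (𝓡 n) (𝓡 n) ∞ (modelPinch n ∘ c) x :=
      ((contMDiff_modelPinch n).comp_contMDiffOn hcs).contMDiffAt (c.open_source.mem_nhds hx)
    refine h1.congr_of_eventuallyEq ?_
    filter_upwards [c.open_source.mem_nhds hx] with y hy
    exact pinch_of_mem c hy
  · -- off the compact `K = c⁻¹(closed unit ball)` the map is constant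
    set K : Set N := c.symm '' closedBall (0 : EuclideanSpace ℝ (Fin n)) 1 with hK
    have hKc : IsCompact K := (isCompact_closedBall _ _).image_of_continuousOn (c.continuousOn_symm.mono hc1)
    have hKs : K ⊆ c.source := by
      rintro _ ⟨y, hy, rfl⟩
      exact c.map_target (hc1 hy)
    have hxK : x ∉ K := fun h ↦ hx (hKs h)
    have hev : pinch c =ᶠ[𝓝 x] fun _ ↦ pole n := by
      filter_upwards [hKc.isClosed.isOpen_compl.mem_nhds hxK] with y hy
      by_cases hys : y ∈ c.source
      · refine pinch_eq_pole c hys ?_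
        by_contra hlt
        push Not at hlt
        exact hy ⟨c y, mem_closedBall_zero_iff.2 hlt.le, c.left_inv hys⟩
      · exact pinch_of_not_mem c hys
    exact contMDiffAt_const.congr_of_eventuallyEq hev

/-- The pinch map is continuous. [folklore] -/
theorem continuous_pinch [T2Space N] [IsManifold (𝓡 n) ∞ N] (hcs : ContMDiffOn (𝓡 n) (𝓡 n) ∞ c c.source)
    (hc1 : closedBall (0 : EuclideanSpace ℝ (Fin n)) 1 ⊆ c.target) : Continuous (pinch c) :=
  (contMDiff_pinch c hcs hc1).continuous

end Pinch


/-! ### The pinch map on local homology -/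

section LocalClass

variable {n}

/-- **The fixed generator of `Hₙ(Sⁿ | σ⁻¹(0); ℤ)`**: the reference generator of `Hₙ(ℝⁿ | 0; ℤ)`
(`μE`) carried back along the stereographic chart. [cite: Bredon1993, VI.7 Thm. 7.15] -/
def pinchLocalClass (n : ℕ) : localHomology ℤ ℤ (sphere (0 : EuclideanSpace ℝ (Fin (n + 1))) 1) (basePoint n) n :=
  (chartTransport (stereo n) (stereo n).open_source subset_rfl (basePoint_mem_source n) n).symm
    ((μE n).localClass (stereo n (basePoint n)))

/-- Transport of a local orientation class along the identity between two names of one point.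
[folklore] -/
theorem map_id_localClass_eq {X : Type*} [TopologicalSpace X] {k : ℕ} (ν : HomologicalOrientation ℤ X k) {x y : X}
    (h : x = y) (hm : MapsTo (ContinuousMap.id X) ({x}ᶜ : Set X) ({y}ᶜ : Set X)) :
    relativeSingularHomology.map ℤ ℤ (ContinuousMap.id X) hm k (ν.localClass x) = ν.localClass y := by
  subst h
  rw [relativeSingularHomology.map_id]
  rfl

variable {N : Type} [TopologicalSpace N] {c : OpenPartialHomeomorph N (EuclideanSpace ℝ (Fin n))}
  {p : N} (hp : p ∈ c.source) (hcp : c p = 0)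

include hp hcp in
/-- The centre of a chart with `c p = 0`. [folklore] -/
theorem symm_zero_eq : c.symm 0 = p := by rw [← hcp, c.left_inv hp]

include hp hcp in
/-- `0` is in the target of a chart with `c p = 0`. [folklore] -/
theorem zero_mem_target : (0 : EuclideanSpace ℝ (Fin n)) ∈ c.target := hcp ▸ c.map_source hp

include hp hcp in
/-- The pinch map at the centre is the base point. [folklore] -/
theorem pinch_center : pinch c p = basePoint n := by
  rw [pinch_eq_symm c hp (by rw [hcp, norm_zero]; norm_num), hcp]
  rfl

include hp hcp in
/-- The pinch map as a map of pairs `(N, N ∖ p) → (Sⁿ, Sⁿ ∖ σ⁻¹(0))`, `p = c⁻¹(0)`. [folklore] -/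
theorem mapsTo_pinch_center : MapsTo (pinch c) ({p}ᶜ : Set N) ({basePoint n}ᶜ : Set _) := by
  have h := mapsTo_pinch c (zero_mem_target hp hcp)
  rwa [symm_zero_eq hp hcp] at h

variable [T1Space N]

open CategoryTheory in
/-- **The pinch map carries the chart-transported reference generator at the centre to the fixed
generator at the base point.**  If the local orientation class `μ_p` is the transport along `c` of
the reference generator of `Hₙ(ℝⁿ | 0)`, then `(pinch c)_* μ_p = pinchLocalClass n`: near `p` the
pinch map is `σ⁻¹ ∘ c`, and local homology only sees a neighbourhood (excision; naturality of the
cross-universe comparison `xEquiv`). [cite: Bredon1993, VI.7 Thm. 7.15] [cite: HatcherAT2002, §3.3 p. 231] -/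
theorem map_pinch_localClass (hcont : Continuous (pinch c)) (μ : HomologicalOrientation ℤ N n)
    (hμ : μ.localClass p = (chartTransport c c.open_source subset_rfl hp n).symm ((μE n).localClass (c p))) :
    relativeSingularHomology.map ℤ ℤ ⟨pinch c, hcont⟩ (mapsTo_pinch_center hp hcp) n (μ.localClass p) =
      pinchLocalClass n := by
  set F : C(N, sphere (0 : EuclideanSpace ℝ (Fin (n + 1))) 1) := ⟨pinch c, hcont⟩ with hF
  have hFm : MapsTo F ({p}ᶜ : Set N) ({basePoint n}ᶜ : Set _) := mapsTo_pinch_center hp hcp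
  -- the open set `U = c⁻¹(B(0, ½))` on which `pinch = σ⁻¹ ∘ c`, and its images
  set U : Set N := c.source ∩ c ⁻¹' ball 0 (1 / 2) with hU
  have hUo : IsOpen U := c.isOpen_inter_preimage isOpen_ball
  have hpU : p ∈ U := ⟨hp, by rw [mem_preimage, hcp]; exact mem_ball_self (by norm_num)⟩
  have hUc : U ⊆ c.source := inter_subset_left
  have hpin : ∀ u ∈ U, pinch c u = (stereo n).symm (c u) := fun u hu ↦
    pinch_eq_symm c hu.1 (mem_ball_zero_iff.1 hu.2).le
  have htgt : ∀ y : EuclideanSpace ℝ (Fin n), y ∈ (stereo n).target := fun y ↦ by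
    rw [stereo_target]; exact mem_univ _
  set V : Set (sphere (0 : EuclideanSpace ℝ (Fin (n + 1))) 1) := (stereo n).symm '' (c '' U) with hV
  have hCU : IsOpen (c '' U) := c.isOpen_image_of_subset_source hUo hUc
  have hVo : IsOpen V := (stereo n).isOpen_image_symm_of_subset_target hCU fun y _ ↦ htgt y
  have hVs : V ⊆ (stereo n).source := by
    rintro _ ⟨y, _, rfl⟩
    exact (stereo n).map_target (htgt y)
  have hPV : basePoint n ∈ V := ⟨c p, ⟨p, hpU, rfl⟩, by rw [hcp]; rfl⟩
  have hSV : IsOpen ((stereo n) '' V) := (stereo n).isOpen_image_of_subset_source hVo hVs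
  -- the restricted pinch map `φ : U → V` and the identity `ψ : c(U) → σ(V)`
  have hφmem : ∀ u : ↥U, pinch c u ∈ V := fun u ↦ ⟨c u, ⟨u, u.2, rfl⟩, (hpin u u.2).symm⟩
  set φ : C(↥U, ↥V) := ⟨fun u ↦ ⟨pinch c u, hφmem u⟩, (hcont.comp continuous_subtype_val).subtype_mk _⟩ with hφdef
  have hψmem : ∀ w : ↥(c '' U), (w : EuclideanSpace ℝ (Fin n)) ∈ (stereo n) '' V := fun w ↦
    ⟨(stereo n).symm w, ⟨w, w.2, rfl⟩, (stereo n).right_inv (htgt w)⟩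
  set ψ : C(↥(c '' U), ↥((stereo n) '' V)) := ⟨fun w ↦ ⟨w, hψmem w⟩, continuous_subtype_val.subtype_mk _⟩
    with hψdef
  set y₀ : ↥U := ⟨p, hpU⟩ with hy₀
  set v₀ : ↥V := ⟨basePoint n, hPV⟩ with hv₀
  have hφ : MapsTo φ ({y₀}ᶜ : Set ↥U) ({v₀}ᶜ : Set ↥V) := fun u hu h ↦
    hu (Subtype.ext (((pinch_eq_basePoint_iff' c (zero_mem_target hp hcp)).1 (congrArg Subtype.val h)).trans
      (symm_zero_eq hp hcp)))
  have hcomm : ∀ u : ↥U, ψ (chartHomeo c hUc u) = chartHomeo (stereo n) hVs (φ u) := fun u ↦ by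
    apply Subtype.ext
    change c u = stereo n (pinch c u)
    rw [hpin u u.2, (stereo n).right_inv (htgt _)]
  have hψ : MapsTo ψ ({chartHomeo c hUc y₀}ᶜ : Set ↥(c '' U))
      ({chartHomeo (stereo n) hVs v₀}ᶜ : Set ↥((stereo n) '' V)) := by
    intro w hw h
    apply hw
    apply Subtype.ext
    have h1 : (w : EuclideanSpace ℝ (Fin n)) = stereo n (basePoint n) := congrArg Subtype.val h
    change (w : EuclideanSpace ℝ (Fin n)) = c p
    rw [h1, stereo_basePoint, hcp]
  -- naturality of the cross-universe comparison: `e₂ (φ_* w) = ψ_* (e₁ w)`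
  have hnat : ∀ w : localHomology ℤ ℤ (↥U) y₀ n,
      localHomology.xEquiv ℤ ℤ (chartHomeo (stereo n) hVs) v₀ n (relativeSingularHomology.map ℤ ℤ φ hφ n w) =
        relativeSingularHomology.map ℤ ℤ ψ hψ n (localHomology.xEquiv ℤ ℤ (chartHomeo c hUc) y₀ n w) := fun w ↦
    relativeSingularHomology.xEquiv_map ℤ ℤ (chartHomeo c hUc) (chartHomeo (stereo n) hVs) φ ψ hcomm _ _ _ _ hφ hψ n w
  -- (A) excision on `N`: `μ_p = (U ↪ N)_* w`
  have hXU : MapsTo (subsetIncl U) ({y₀}ᶜ : Set ↥U) ({p}ᶜ : Set N) := fun w hw hwy ↦ hw (Subtype.ext hwy)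
  have hXV : MapsTo (subsetIncl V) ({v₀}ᶜ : Set ↥V) ({basePoint n}ᶜ : Set _) := fun w hw hwy ↦ hw (Subtype.ext hwy)
  set w := (localHomology.openSubsetIso ℤ ℤ hUo hpU n).inv (μ.localClass p) with hw
  have hA : relativeSingularHomology.map ℤ ℤ (subsetIncl U) hXU n w = μ.localClass p := by
    have h1 : relativeSingularHomology.map ℤ ℤ (subsetIncl U) hXU n w = (localHomology.openSubsetIso ℤ ℤ hUo hpU n).hom w := by
      rw [localHomology.openSubsetIso, asIso_hom]
    rw [h1, hw, Iso.inv_hom_id_apply]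
  -- (B) `pinch_* ((U ↪ N)_* w) = (V ↪ Sⁿ)_* (φ_* w)`
  have hB : relativeSingularHomology.map ℤ ℤ F hFm n (μ.localClass p) =
      relativeSingularHomology.map ℤ ℤ (subsetIncl V) hXV n (relativeSingularHomology.map ℤ ℤ φ hφ n w) := by
    have hc1 : MapsTo (F.comp (subsetIncl U)) ({y₀}ᶜ : Set ↥U) ({basePoint n}ᶜ : Set _) := hFm.comp hXU
    have hc2 : MapsTo ((subsetIncl V).comp φ) ({y₀}ᶜ : Set ↥U) ({basePoint n}ᶜ : Set _) := hXV.comp hφ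
    rw [← hA, ← map_comp_apply _ _ hXU hFm hc1, ← map_comp_apply _ _ hφ hXV hc2]
    rw [map_congr_fun (f := F.comp (subsetIncl U)) (f' := (subsetIncl V).comp φ) (ContinuousMap.ext fun _ ↦ rfl) hc1 hc2 n]
  -- (C) excision on `N` and the chart: `e₁ w = (c(U) ↪ ℝⁿ)⁻¹_* μE_{c p}`
  have hC : localHomology.xEquiv ℤ ℤ (chartHomeo c hUc) y₀ n w =
      (localHomology.openSubsetIso ℤ ℤ hCU (mem_image_of_mem c hpU) n).inv ((μE n).localClass (c p)) := by
    have h1 : chartTransport c hUo hUc hpU n (μ.localClass p) = (μE n).localClass (c p) := by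
      rw [chartTransport_mono c hUo c.open_source hUc subset_rfl hpU n, hμ, LinearEquiv.apply_symm_apply]
    rw [chartTransport_apply] at h1
    rw [← h1, Iso.hom_inv_id_apply]
  -- (D) the identity `ψ`: `ψ_* ((c(U) ↪ ℝⁿ)⁻¹_* μE_{c p}) = (σ(V) ↪ ℝⁿ)⁻¹_* μE_{σ(base)}`
  have hD : relativeSingularHomology.map ℤ ℤ ψ hψ n
      ((localHomology.openSubsetIso ℤ ℤ hCU (mem_image_of_mem c hpU) n).inv ((μE n).localClass (c p))) =
      (localHomology.openSubsetIso ℤ ℤ hSV (mem_image_of_mem (stereo n) hPV) n).inv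
        ((μE n).localClass (stereo n (basePoint n))) := by
    set m' := (localHomology.openSubsetIso ℤ ℤ hCU (mem_image_of_mem c hpU) n).inv ((μE n).localClass (c p)) with hm'
    have hE1 : MapsTo (subsetIncl ((stereo n) '' V)) ({chartHomeo (stereo n) hVs v₀}ᶜ : Set _)
        ({stereo n (basePoint n)}ᶜ : Set (EuclideanSpace ℝ (Fin n))) :=
      localHomology.mapsTo_subsetIncl_compl (mem_image_of_mem (stereo n) hPV)
    have hE2 : MapsTo (subsetIncl (c '' U)) ({chartHomeo c hUc y₀}ᶜ : Set _) ({c p}ᶜ : Set (EuclideanSpace ℝ (Fin n))) :=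
      localHomology.mapsTo_subsetIncl_compl (mem_image_of_mem c hpU)
    have hpt : c p = stereo n (basePoint n) := by rw [stereo_basePoint, hcp]
    have hE3 : MapsTo (ContinuousMap.id (EuclideanSpace ℝ (Fin n))) ({c p}ᶜ : Set _) ({stereo n (basePoint n)}ᶜ : Set _) := by
      rw [hpt]
      exact mapsTo_id _
    have h2 : relativeSingularHomology.map ℤ ℤ (subsetIncl (c '' U)) hE2 n m' = (μE n).localClass (c p) := by
      have h3 : relativeSingularHomology.map ℤ ℤ (subsetIncl (c '' U)) hE2 n m' =
          (localHomology.openSubsetIso ℤ ℤ hCU (mem_image_of_mem c hpU) n).hom m' := by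
        rw [localHomology.openSubsetIso, asIso_hom]
        rfl
      rw [h3, hm', Iso.inv_hom_id_apply]
    have key : relativeSingularHomology.map ℤ ℤ (subsetIncl ((stereo n) '' V)) hE1 n (relativeSingularHomology.map ℤ ℤ ψ hψ n m') =
        (μE n).localClass (stereo n (basePoint n)) := by
      rw [← map_comp_apply _ _ hψ hE1 (hE1.comp hψ),
        map_congr_fun (f := (subsetIncl ((stereo n) '' V)).comp ψ) (f' := (ContinuousMap.id _).comp (subsetIncl (c '' U)))
          (ContinuousMap.ext fun _ ↦ rfl) _ (hE3.comp hE2) n,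
        map_comp_apply _ _ hE2 hE3 (hE3.comp hE2), h2, map_id_localClass_eq (μE n) hpt hE3]
    have h4 : relativeSingularHomology.map ℤ ℤ (subsetIncl ((stereo n) '' V)) hE1 n (relativeSingularHomology.map ℤ ℤ ψ hψ n m') =
        (localHomology.openSubsetIso ℤ ℤ hSV (mem_image_of_mem (stereo n) hPV) n).hom
          (relativeSingularHomology.map ℤ ℤ ψ hψ n m') := by
      rw [localHomology.openSubsetIso, asIso_hom]
      rfl
    rw [← key, h4, Iso.hom_inv_id_apply]
  -- (E) assembly
  have hT : chartTransport (stereo n) hVo hVs hPV n =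
      chartTransport (stereo n) (stereo n).open_source subset_rfl (basePoint_mem_source n) n :=
    LinearEquiv.ext fun z ↦ chartTransport_mono (stereo n) hVo (stereo n).open_source hVs subset_rfl hPV n z
  have hXV' : relativeSingularHomology.map ℤ ℤ (subsetIncl V) hXV n = (localHomology.openSubsetIso ℤ ℤ hVo hPV n).hom := by
    rw [localHomology.openSubsetIso, asIso_hom]
  calc relativeSingularHomology.map ℤ ℤ F hFm n (μ.localClass p)
      = relativeSingularHomology.map ℤ ℤ (subsetIncl V) hXV n (relativeSingularHomology.map ℤ ℤ φ hφ n w) := hB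
    _ = relativeSingularHomology.map ℤ ℤ (subsetIncl V) hXV n
          ((localHomology.xEquiv ℤ ℤ (chartHomeo (stereo n) hVs) v₀ n).symm
            (relativeSingularHomology.map ℤ ℤ ψ hψ n (localHomology.xEquiv ℤ ℤ (chartHomeo c hUc) y₀ n w))) := by
          rw [← hnat, LinearEquiv.symm_apply_apply]
    _ = (localHomology.openSubsetIso ℤ ℤ hVo hPV n).hom
          ((localHomology.xEquiv ℤ ℤ (chartHomeo (stereo n) hVs) v₀ n).symm
            ((localHomology.openSubsetIso ℤ ℤ hSV (mem_image_of_mem (stereo n) hPV) n).inv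
              ((μE n).localClass (stereo n (basePoint n))))) := by
          rw [hC, hD, hXV']
    _ = (chartTransport (stereo n) hVo hVs hPV n).symm ((μE n).localClass (stereo n (basePoint n))) := by
          rw [chartTransport_symm_apply]
    _ = pinchLocalClass n := by
          rw [pinchLocalClass, hT]

end LocalClass


/-! ### The pinch map on fundamental classes -/

section Fundamental

variable {n}
variable {N : Type} [TopologicalSpace N] [T2Space N] [CompactSpace N] [ChartedSpace (EuclideanSpace ℝ (Fin n)) N]
  {c : OpenPartialHomeomorph N (EuclideanSpace ℝ (Fin n))} {p : N} (hp : p ∈ c.source) (hcp : c p = 0)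

include hcp in
/-- **`(pinch c)_* [N]_μ` restricts at the base point to the fixed generator** (closed `N`, `μ_p` the
`c`-transport of the reference generator). [cite: Bredon1993, VI.7 Thm. 7.15] [cite: HatcherAT2002, §3.3 Thm. 3.26] -/
theorem toLocal_map_pinch_fundamentalClass (hcont : Continuous (pinch c)) (μ : HomologicalOrientation ℤ N n)
    (hμ : μ.localClass p = (chartTransport c c.open_source subset_rfl hp n).symm ((μE n).localClass (c p))) :
    singularHomology.toLocal ℤ ℤ (basePoint n) n (singularHomology.map ℤ ℤ ⟨pinch c, hcont⟩ n μ.fundamentalClass) =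
      pinchLocalClass n := by
  rw [singularHomology.toLocal_map_apply' ℤ ℤ ⟨pinch c, hcont⟩ p (basePoint n) (mapsTo_pinch_center hp hcp) n,
    HomologicalOrientation.isFundamentalClass_fundamentalClass_holds n μ p, map_pinch_localClass hp hcp hcont μ hμ]

/-- `Sⁿ` is connected for `n ≥ 1`. [folklore] -/
theorem connectedSpace_sphere (hn : 0 < n) : ConnectedSpace (sphere (0 : EuclideanSpace ℝ (Fin (n + 1))) 1) := by
  refine isConnected_iff_connectedSpace.1 (isConnected_sphere ?_ (0 : EuclideanSpace ℝ (Fin (n + 1))) zero_le_one)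
  rw [← Module.finrank_eq_rank, finrank_euclideanSpace_fin]
  exact_mod_cast Nat.succ_lt_succ hn

include hcp in
/-- **Any two pinch push-forwards of fundamental classes coincide** (`n ≥ 1`): for closed manifolds
`N, N'` of dimension `n`, charts `c, c'` with smooth-enough pinch maps and `ℤ`-orientations `μ, μ'`
whose local classes at the centres are the chart transports of the reference generator,
`(pinch c)_* [N]_μ = (pinch c')_* [N']_{μ'}` in `Hₙ(Sⁿ; ℤ)` — both restrict to `pinchLocalClass n`
at the base point, and `Hₙ(Sⁿ) → Hₙ(Sⁿ | pt)` is injective (Hatcher Thm. 3.26(b)).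
[cite: HatcherAT2002, §3.3 Thm. 3.26 and Exercise 3.3.7] [cite: Bredon1993, V.6] -/
theorem map_pinch_fundamentalClass_eq (hn : 0 < n) (hcont : Continuous (pinch c)) (μ : HomologicalOrientation ℤ N n)
    (hμ : μ.localClass p = (chartTransport c c.open_source subset_rfl hp n).symm ((μE n).localClass (c p)))
    {N' : Type} [TopologicalSpace N'] [T2Space N'] [CompactSpace N'] [ChartedSpace (EuclideanSpace ℝ (Fin n)) N']
    {c' : OpenPartialHomeomorph N' (EuclideanSpace ℝ (Fin n))} {p' : N'} (hp' : p' ∈ c'.source) (hcp' : c' p' = 0)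
    (hcont' : Continuous (pinch c')) (μ' : HomologicalOrientation ℤ N' n)
    (hμ' : μ'.localClass p' = (chartTransport c' c'.open_source subset_rfl hp' n).symm ((μE n).localClass (c' p'))) :
    singularHomology.map ℤ ℤ ⟨pinch c, hcont⟩ n μ.fundamentalClass =
      singularHomology.map ℤ ℤ ⟨pinch c', hcont'⟩ n μ'.fundamentalClass := by
  haveI := connectedSpace_sphere hn
  apply singularHomology.toLocal_injective_of_connectedSpace_holds ℤ ℤ (sphere (0 : EuclideanSpace ℝ (Fin (n + 1))) 1) n
    (basePoint n)
  rw [toLocal_map_pinch_fundamentalClass hp hcp hcont μ hμ, toLocal_map_pinch_fundamentalClass hp' hcp' hcont' μ' hμ']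

end Fundamental


/-! ### Post-composing a chart with a homeomorphism of `ℝⁿ` -/

section TransHomeomorph

open CategoryTheory

variable {n}
variable {X : Type} [TopologicalSpace X] (c : OpenPartialHomeomorph X (EuclideanSpace ℝ (Fin n)))
  (D : EuclideanSpace ℝ (Fin n) ≃ₜ EuclideanSpace ℝ (Fin n))

/-- Post-composing with a homeomorphism of the model does not shrink the source. [folklore] -/
theorem subset_trans_homeomorph_source {U : Set X} (hUc : U ⊆ c.source) :
    U ⊆ (c.trans D.toOpenPartialHomeomorph).source := by
  rw [OpenPartialHomeomorph.trans_source, Homeomorph.toOpenPartialHomeomorph_source, preimage_univ, inter_univ]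
  exact hUc

variable [T1Space X]

/-- **Transport along `D ∘ c` versus along `c`**: for a homeomorphism `D` of `ℝⁿ` and an orientation
`ν` of `ℝⁿ`, carrying `ν_{D(c y)}` back along the chart `D ∘ c` is carrying `(D^* ν)_{c y}` back
along `c` (naturality of excision and of the cross-universe comparison). [cite: HatcherAT2002, §3.3 p. 231] -/
theorem chartTransport_trans_homeomorph_symm {U : Set X} (hU : IsOpen U) (hUc : U ⊆ c.source) {y : X} (hy : y ∈ U)
    (k : ℕ) (ν : HomologicalOrientation ℤ (EuclideanSpace ℝ (Fin n)) k) :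
    (chartTransport (c.trans D.toOpenPartialHomeomorph) hU (subset_trans_homeomorph_source c D hUc) hy k).symm
        (ν.localClass (D (c y))) =
      (chartTransport c hU hUc hy k).symm ((ν.comap D).localClass (c y)) := by
  set c' := c.trans D.toOpenPartialHomeomorph with hc'
  have hUc' : U ⊆ c'.source := subset_trans_homeomorph_source c D hUc
  set x₀ : ↥(c '' U) := chartHomeo c hUc ⟨y, hy⟩ with hx₀
  set x₁ : ↥(c' '' U) := chartHomeo c' hUc' ⟨y, hy⟩ with hx₁
  have hx₀v : (x₀ : EuclideanSpace ℝ (Fin n)) = c y := rfl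
  have hx₁v : (x₁ : EuclideanSpace ℝ (Fin n)) = D (c y) := rfl
  -- the chart change is `D` restricted
  have hG : ∀ w : ↥(c '' U), (chartChange c c' hUc hUc' w : EuclideanSpace ℝ (Fin n)) = D w := by
    rintro ⟨_, u, hu, rfl⟩
    change D (c (c.symm (c u))) = D (c u)
    rw [c.left_inv (hUc hu)]
  have h : MapsTo (chartChange c c' hUc hUc') ({x₀}ᶜ : Set _) {x₁}ᶜ :=
    mapsTo_compl_singleton_of_injective (Homeomorph.injective _) (by
      apply Subtype.ext
      rw [hG]
      rfl)
  apply (chartTransport c' hU hUc' hy k).injective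
  rw [LinearEquiv.apply_symm_apply, chartTransport_trans c c' hU hUc hUc' hy k h, LinearEquiv.apply_symm_apply]
  -- unfold `comap`: `(D^* ν)_{c y} = (D⁻¹)_* ν_{D (c y)}`
  rw [HomologicalOrientation.comap_localClass]
  have hV : IsOpen (c '' U) := c.isOpen_image_of_subset_source hU hUc
  have hV' : IsOpen (c' '' U) := c'.isOpen_image_of_subset_source hU hUc'
  have hE : MapsTo (subsetIncl (c '' U)) ({x₀}ᶜ : Set _) ({c y}ᶜ : Set (EuclideanSpace ℝ (Fin n))) :=
    localHomology.mapsTo_subsetIncl_compl (mem_image_of_mem c hy)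
  have hE' : MapsTo (subsetIncl (c' '' U)) ({x₁}ᶜ : Set _) ({D (c y)}ᶜ : Set (EuclideanSpace ℝ (Fin n))) :=
    localHomology.mapsTo_subsetIncl_compl (mem_image_of_mem c' hy)
  set Dc : C(EuclideanSpace ℝ (Fin n), EuclideanSpace ℝ (Fin n)) := (D : C(EuclideanSpace ℝ (Fin n), EuclideanSpace ℝ (Fin n)))
    with hDc
  set Dsc : C(EuclideanSpace ℝ (Fin n), EuclideanSpace ℝ (Fin n)) :=
    (D.symm : C(EuclideanSpace ℝ (Fin n), EuclideanSpace ℝ (Fin n))) with hDsc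
  have hD : MapsTo Dc ({c y}ᶜ : Set _) ({D (c y)}ᶜ : Set _) := mapsTo_compl_singleton D.toEquiv (c y)
  have hDs : MapsTo Dsc ({D (c y)}ᶜ : Set _) ({c y}ᶜ : Set _) := mapsTo_symm_compl_singleton D.toEquiv (c y)
  set m := ν.localClass (D (c y)) with hm
  -- `(exc')⁻¹`-free form: apply `exc'.hom ∘ chartChange_* ∘ exc.inv` to `(D⁻¹)_* m` and get `m`
  have hhom' : ∀ z', (localHomology.openSubsetIso ℤ ℤ hV' (mem_image_of_mem c' hy) k).hom z' =
      relativeSingularHomology.map ℤ ℤ (subsetIncl (c' '' U)) hE' k z' := fun z' ↦ by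
    rw [localHomology.openSubsetIso, asIso_hom]
    rfl
  have hhom : ∀ z, (localHomology.openSubsetIso ℤ ℤ hV (mem_image_of_mem c hy) k).hom z =
      relativeSingularHomology.map ℤ ℤ (subsetIncl (c '' U)) hE k z := fun z ↦ by
    rw [localHomology.openSubsetIso, asIso_hom]
    rfl
  have h1 : ∀ z : localHomology ℤ ℤ (↥(c '' U)) x₀ k,
      (localHomology.openSubsetIso ℤ ℤ hV' (mem_image_of_mem c' hy) k).hom
          (relativeSingularHomology.map ℤ ℤ (chartChange c c' hUc hUc' : C(↥(c '' U), ↥(c' '' U))) h k z) =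
        relativeSingularHomology.map ℤ ℤ Dc hD k ((localHomology.openSubsetIso ℤ ℤ hV (mem_image_of_mem c hy) k).hom z) := by
    intro z
    rw [hhom', hhom]
    have e1 := map_comp_apply (chartChange c c' hUc hUc' : C(↥(c '' U), ↥(c' '' U))) (subsetIncl (c' '' U)) h hE'
      (hE'.comp h) k z
    have e2 := map_comp_apply (subsetIncl (c '' U)) Dc hE hD (hD.comp hE) k z
    rw [← e1, ← e2,
      map_congr_fun (f := (subsetIncl (c' '' U)).comp (chartChange c c' hUc hUc' : C(↥(c '' U), ↥(c' '' U))))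
        (f' := Dc.comp (subsetIncl (c '' U))) (ContinuousMap.ext fun w ↦ hG w) (hE'.comp h) (hD.comp hE) k]
  have h2 : relativeSingularHomology.map ℤ ℤ Dc hD k ((localHomology.mapIso ℤ ℤ D (c y) k).inv m) = m := by
    have e3 : (localHomology.mapIso ℤ ℤ D (c y) k).inv m = relativeSingularHomology.map ℤ ℤ Dsc hDs k m := rfl
    have e4 := map_comp_apply Dsc Dc hDs hD (hD.comp hDs) k m
    rw [e3, ← e4,
      map_congr_fun (f := Dc.comp Dsc) (f' := ContinuousMap.id _)
        (ContinuousMap.ext fun w ↦ D.apply_symm_apply w) (hD.comp hDs) (mapsTo_id _) k,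
      relativeSingularHomology.map_id]
    rfl
  rw [h1, Iso.inv_hom_id_apply]
  exact h2.symm

end TransHomeomorph

/-! ### The oriented unit chart of a smooth orientation -/

section OrientedChart

variable {n}
variable {N : Type} [TopologicalSpace N] [ChartedSpace (EuclideanSpace ℝ (Fin n)) N]

variable (n) in
/-- Some ball about `c_p p` lies in the target of the preferred chart at `p`. [folklore] -/
theorem exists_ball_subset_chart_target (p : N) :
    ∃ ε > 0, ball (chartAt (EuclideanSpace ℝ (Fin n)) p p) ε ⊆ (chartAt (EuclideanSpace ℝ (Fin n)) p).target :=
  Metric.isOpen_iff.1 (chartAt _ p).open_target _ (mem_chart_target _ p)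

variable (n) in
/-- A radius `ε > 0` with `B(c_p p, ε)` inside the target of the preferred chart at `p`. [folklore] -/
def rad (p : N) : ℝ := (exists_ball_subset_chart_target n p).choose

variable (n) in
/-- The radius is positive. [folklore] -/
theorem rad_pos (p : N) : 0 < rad n p := (exists_ball_subset_chart_target n p).choose_spec.1

variable (n) in
/-- The ball of that radius lies in the chart target. [folklore] -/
theorem ball_rad_subset (p : N) :
    ball (chartAt (EuclideanSpace ℝ (Fin n)) p p) (rad n p) ⊆ (chartAt (EuclideanSpace ℝ (Fin n)) p).target :=
  (exists_ball_subset_chart_target n p).choose_spec.2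

variable [IsManifold (𝓡 n) 1 N] (o : SmoothOrientation (𝓡 n) N) (p : N)

/-- `Rl o p` is an involution. [folklore] -/
theorem Rl_Rl (z : EuclideanSpace ℝ (Fin n)) : Rl o p (Rl o p z) = z := by
  unfold Rl
  split_ifs
  · rfl
  · exact reflE_reflE z

/-- The inverse scale `s = ε / (2 (‖R‖ + 1))` of the unit chart. [folklore] -/
def invScale : ℝ := rad n p / (2 * (‖Rl o p‖ + 1))

/-- The inverse scale is positive. [folklore] -/
theorem invScale_pos : 0 < invScale o p := by
  unfold invScale
  have := rad_pos n p
  positivity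

/-- The orienting affine part `u ↦ s⁻¹ (u - R x₀)` (a translation followed by a positive homothety;
it preserves the reference orientation of `ℝⁿ`). [folklore] -/
def affinePart : EuclideanSpace ℝ (Fin n) ≃ₜ EuclideanSpace ℝ (Fin n) :=
  (Homeomorph.addRight (-Rl o p (chartAt (EuclideanSpace ℝ (Fin n)) p p))).trans
    (Homeomorph.smulOfNeZero (invScale o p)⁻¹ (inv_ne_zero (invScale_pos o p).ne'))

/-- Values of the affine part. [folklore] -/
theorem affinePart_apply (u : EuclideanSpace ℝ (Fin n)) :
    affinePart o p u = (invScale o p)⁻¹ • (u - Rl o p (chartAt (EuclideanSpace ℝ (Fin n)) p p)) := by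
  simp [affinePart, sub_eq_add_neg]

/-- Values of the inverse of the affine part. [folklore] -/
theorem affinePart_symm_apply (z : EuclideanSpace ℝ (Fin n)) :
    (affinePart o p).symm z = invScale o p • z + Rl o p (chartAt (EuclideanSpace ℝ (Fin n)) p p) := by
  apply (affinePart o p).injective
  rw [Homeomorph.apply_symm_apply, affinePart_apply, add_sub_cancel_right, smul_smul,
    inv_mul_cancel₀ (invScale_pos o p).ne', one_smul]

/-- The affine part preserves the reference orientation `μE` of `ℝⁿ`. [folklore] -/
theorem pres_affinePart : Pres (μE n) (affinePart o p) := by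
  refine pres_of_affine (affinePart o p) ((invScale o p)⁻¹ • ContinuousLinearMap.id ℝ _) ?_
    (-((invScale o p)⁻¹ • Rl o p (chartAt (EuclideanSpace ℝ (Fin n)) p p))) fun z ↦ ?_
  · rw [ContinuousLinearMap.det, ContinuousLinearMap.toLinearMap_smul, ContinuousLinearMap.coe_id, LinearMap.det_smul,
      LinearMap.det_id, mul_one]
    exact pow_pos (inv_pos.2 (invScale_pos o p)) _
  · rw [affinePart_apply, smul_sub, FunLike.coe_smul, Pi.smul_apply, ContinuousLinearMap.id_apply,
      sub_eq_add_neg]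

/-- **The normaliser** `D = A ∘ R`: the orienting reflection-or-identity `R = Rh o p` followed by the
affine part. [folklore] -/
def normaliser : EuclideanSpace ℝ (Fin n) ≃ₜ EuclideanSpace ℝ (Fin n) := (Rh o p).trans (affinePart o p)

/-- Values of the normaliser. [folklore] -/
theorem normaliser_apply (y : EuclideanSpace ℝ (Fin n)) :
    normaliser o p y = (invScale o p)⁻¹ • (Rl o p y - Rl o p (chartAt (EuclideanSpace ℝ (Fin n)) p p)) := by
  rw [normaliser, Homeomorph.trans_apply, affinePart_apply, Rh_apply]

/-- Values of the inverse normaliser. [folklore] -/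
theorem normaliser_symm_apply (z : EuclideanSpace ℝ (Fin n)) :
    (normaliser o p).symm z = chartAt (EuclideanSpace ℝ (Fin n)) p p + Rl o p (invScale o p • z) := by
  change (Rh o p).symm ((affinePart o p).symm z) = _
  rw [affinePart_symm_apply, Rh_symm_apply, map_add, Rl_Rl, add_comm]

/-- `D^* μE = μR o p` (the affine part preserves `μE`; the reflection-or-identity turns it into the
oriented reference orientation). [folklore] -/
theorem comap_normaliser : (μE n).comap (normaliser o p) = μR o p := by
  rw [normaliser, comap_trans, pres_iff_comap_eq.1 (pres_affinePart o p)]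

/-- **The oriented unit chart at `p`**: the preferred chart followed by the normaliser — centred
(`unitChart_self`), with the closed unit ball in its target (`closedBall_subset_unitChart_target`),
and POSITIVELY ORIENTED in the homological sense: the local class of `homologicalOrientationOfSmooth o`
at `p` is the transport along it of the reference generator (`localClass_eq_unitChart`).
[cite: Bredon1993, VI.7 Thm. 7.15] [cite: MilnorStasheff1974, Appendix A] -/
def unitChart : OpenPartialHomeomorph N (EuclideanSpace ℝ (Fin n)) :=
  (chartAt (EuclideanSpace ℝ (Fin n)) p).trans (normaliser o p).toOpenPartialHomeomorph

/-- Values of the unit chart. [folklore] -/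
theorem unitChart_apply (y : N) : unitChart o p y = normaliser o p (chartAt (EuclideanSpace ℝ (Fin n)) p y) := rfl

/-- The unit chart has the source of the preferred chart. [folklore] -/
theorem unitChart_source : (unitChart o p).source = (chartAt (EuclideanSpace ℝ (Fin n)) p).source := by
  rw [unitChart, OpenPartialHomeomorph.trans_source, Homeomorph.toOpenPartialHomeomorph_source, preimage_univ, inter_univ]

/-- `p` lies in the source of its unit chart. [folklore] -/
theorem mem_unitChart_source : p ∈ (unitChart o p).source := by
  rw [unitChart_source]
  exact mem_chart_source _ p

/-- The unit chart is centred: `c(p) = 0`. [folklore] -/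
theorem unitChart_self : unitChart o p p = 0 := by
  rw [unitChart_apply, normaliser_apply, sub_self, smul_zero]

/-- Values of the inverse unit chart. [folklore] -/
theorem unitChart_symm_apply (z : EuclideanSpace ℝ (Fin n)) :
    (unitChart o p).symm z = (chartAt (EuclideanSpace ℝ (Fin n)) p).symm ((normaliser o p).symm z) := rfl

/-- The closed unit ball lies in the target of the unit chart. [folklore] -/
theorem closedBall_subset_unitChart_target : closedBall (0 : EuclideanSpace ℝ (Fin n)) 1 ⊆ (unitChart o p).target := by
  intro z hz
  rw [unitChart, OpenPartialHomeomorph.trans_target, Homeomorph.toOpenPartialHomeomorph_target, univ_inter, mem_preimage]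
  change (normaliser o p).symm z ∈ (chartAt (EuclideanSpace ℝ (Fin n)) p).target
  refine ball_rad_subset n p ?_
  rw [normaliser_symm_apply, mem_ball, dist_eq_norm, add_sub_cancel_left, map_smul, norm_smul, Real.norm_eq_abs,
    abs_of_pos (invScale_pos o p)]
  have h1 : ‖Rl o p z‖ ≤ (‖Rl o p‖ + 1) * 1 :=
    ((Rl o p).le_opNorm z).trans (mul_le_mul (le_add_of_nonneg_right zero_le_one) (mem_closedBall_zero_iff.1 hz)
      (norm_nonneg _) (by positivity))
  have h2 : 0 < ‖Rl o p‖ + 1 := by positivity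
  calc invScale o p * ‖Rl o p z‖ ≤ invScale o p * ((‖Rl o p‖ + 1) * 1) :=
        mul_le_mul_of_nonneg_left h1 (invScale_pos o p).le
    _ = rad n p / 2 := by unfold invScale; field_simp
    _ < rad n p := by linarith [rad_pos n p]

/-- The unit chart is `C^m` on its source whenever the manifold is `C^m`. [folklore] -/
theorem contMDiffOn_unitChart {m : WithTop ℕ∞} [IsManifold (𝓡 n) m N] :
    ContMDiffOn (𝓡 n) (𝓡 n) m (unitChart o p) (unitChart o p).source := by
  rw [unitChart_source]
  have h1 : ContMDiff (𝓡 n) (𝓡 n) m (normaliser o p) := by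
    have h2 : ContDiff ℝ ω fun y : EuclideanSpace ℝ (Fin n) ↦
        (invScale o p)⁻¹ • (Rl o p y - Rl o p (chartAt (EuclideanSpace ℝ (Fin n)) p p)) :=
      ((Rl o p).contDiff.sub contDiff_const).const_smul _
    have h3 : (normaliser o p : EuclideanSpace ℝ (Fin n) → EuclideanSpace ℝ (Fin n)) = fun y ↦
        (invScale o p)⁻¹ • (Rl o p y - Rl o p (chartAt (EuclideanSpace ℝ (Fin n)) p p)) := funext (normaliser_apply o p)
    rw [h3]
    exact (h2.of_le le_top).contMDiff
  exact h1.comp_contMDiffOn contMDiffOn_chart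

variable [T1Space N]

/-- **The unit chart is positively oriented**: the local class of `homologicalOrientationOfSmooth o`
at `p` is the transport along `unitChart o p` of the reference generator of `Hₙ(ℝⁿ | 0)`.
[cite: Bredon1993, VI.7 Thm. 7.15] [cite: MilnorStasheff1974, Appendix A] -/
theorem localClass_eq_unitChart :
    (homologicalOrientationOfSmooth o).localClass p =
      (chartTransport (unitChart o p) (unitChart o p).open_source subset_rfl (mem_unitChart_source o p) n).symm
        ((μE n).localClass (unitChart o p p)) := by
  have hU : IsOpen (chartAt (EuclideanSpace ℝ (Fin n)) p).source := (chartAt _ p).open_source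
  have hy : p ∈ (chartAt (EuclideanSpace ℝ (Fin n)) p).source := mem_chart_source _ p
  have hUU' : (chartAt (EuclideanSpace ℝ (Fin n)) p).source ⊆ (unitChart o p).source :=
    subset_trans_homeomorph_source (chartAt _ p) (normaliser o p) subset_rfl
  have hT : chartTransport (unitChart o p) (unitChart o p).open_source subset_rfl (mem_unitChart_source o p) n =
      chartTransport (unitChart o p) hU hUU' hy n :=
    LinearEquiv.ext fun z ↦ (chartTransport_mono (unitChart o p) hU (unitChart o p).open_source hUU' subset_rfl hy n z).symm
  rw [hT]
  change localClassX o p =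
    (chartTransport ((chartAt (EuclideanSpace ℝ (Fin n)) p).trans (normaliser o p).toOpenPartialHomeomorph) hU
      (subset_trans_homeomorph_source (chartAt _ p) (normaliser o p) subset_rfl) hy n).symm
      ((μE n).localClass (normaliser o p (chartAt (EuclideanSpace ℝ (Fin n)) p p)))
  rw [chartTransport_trans_homeomorph_symm (chartAt _ p) (normaliser o p) hU subset_rfl hy n (μE n), comap_normaliser]
  rfl

end OrientedChart


/-! ### The oriented pinch map of a smoothly oriented manifold -/

section Oriented

variable {n}
variable {N : Type} [TopologicalSpace N] [ChartedSpace (EuclideanSpace ℝ (Fin n)) N] [IsManifold (𝓡 n) ∞ N]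
  (o : SmoothOrientation (𝓡 n) N) (p : N)

/-- **The oriented pinch map at `p`**: the pinch map of the oriented unit chart of `o` at `p`.
[cite: Bredon1993, V.6] [cite: MilnorTDV1965, §4–§5] -/
def orientedPinch : N → sphere (0 : EuclideanSpace ℝ (Fin (n + 1))) 1 := pinch (unitChart o p)

/-- The oriented pinch map is `C^∞` (`N` Hausdorff). [cite: MilnorTDV1965, §4] -/
theorem contMDiff_orientedPinch [T2Space N] : ContMDiff (𝓡 n) (𝓡 n) ∞ (orientedPinch o p) :=
  contMDiff_pinch _ (contMDiffOn_unitChart o p) (closedBall_subset_unitChart_target o p)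

/-- The oriented pinch map is continuous. [folklore] -/
theorem continuous_orientedPinch [T2Space N] : Continuous (orientedPinch o p) := (contMDiff_orientedPinch o p).continuous

/-- The fibre of the base point is `{p}`. [folklore] -/
theorem orientedPinch_eq_basePoint_iff {x : N} : orientedPinch o p x = basePoint n ↔ x = p := by
  rw [orientedPinch, pinch_eq_basePoint_iff' _ (zero_mem_target (mem_unitChart_source o p) (unitChart_self o p)),
    symm_zero_eq (mem_unitChart_source o p) (unitChart_self o p)]

/-- The oriented pinch map sends `p` to the base point. [folklore] -/
theorem orientedPinch_self : orientedPinch o p p = basePoint n := (orientedPinch_eq_basePoint_iff o p).2 rfl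

/-- Near `p` (on `c⁻¹(B̄(0, ½))`, `c` the unit chart) the oriented pinch map is `σ⁻¹ ∘ c`. [folklore] -/
theorem orientedPinch_eq_symm {x : N} (hx : x ∈ (unitChart o p).source) (hcx : ‖unitChart o p x‖ ≤ 1 / 2) :
    orientedPinch o p x = (stereo n).symm (unitChart o p x) :=
  pinch_eq_symm _ hx hcx

/-- Off `c⁻¹(B(0, 1))` the oriented pinch map is the pole. [folklore] -/
theorem orientedPinch_eq_pole {x : N} (hx : x ∉ (unitChart o p).source ∨ 1 ≤ ‖unitChart o p x‖) :
    orientedPinch o p x = pole n := by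
  by_cases h : x ∈ (unitChart o p).source
  · exact pinch_eq_pole _ h (hx.resolve_left (not_not.2 h))
  · exact pinch_of_not_mem _ h

variable [T2Space N] [CompactSpace N]

/-- **`(orientedPinch o p)_* [N]_{μ_o}` restricts at the base point to the fixed generator.**
[cite: Bredon1993, VI.7 Thm. 7.15] -/
theorem toLocal_map_orientedPinch_fundamentalClass :
    singularHomology.toLocal ℤ ℤ (basePoint n) n
        (singularHomology.map ℤ ℤ ⟨orientedPinch o p, continuous_orientedPinch o p⟩ n
          (homologicalOrientationOfSmooth o).fundamentalClass) =
      pinchLocalClass n :=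
  toLocal_map_pinch_fundamentalClass (mem_unitChart_source o p) (unitChart_self o p) (continuous_orientedPinch o p) _
    (localClass_eq_unitChart o p)

/-- **Universality of the pushed fundamental class**: for any two closed smoothly oriented
`n`-manifolds (`n ≥ 1`) and base points, the oriented pinch maps push the fundamental classes of the
attached `ℤ`-orientations to THE SAME class of `Hₙ(Sⁿ; ℤ)` ("the oriented pinch map has degree one").
[cite: HatcherAT2002, §3.3 Exercise 3.3.7] [cite: Bredon1993, V.6] [cite: MilnorTDV1965, §5] -/
theorem map_orientedPinch_fundamentalClass_eq (hn : 0 < n) {N' : Type} [TopologicalSpace N'] [T2Space N']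
    [ChartedSpace (EuclideanSpace ℝ (Fin n)) N'] [IsManifold (𝓡 n) ∞ N'] [CompactSpace N']
    (o' : SmoothOrientation (𝓡 n) N') (p' : N') :
    singularHomology.map ℤ ℤ ⟨orientedPinch o p, continuous_orientedPinch o p⟩ n
        (homologicalOrientationOfSmooth o).fundamentalClass =
      singularHomology.map ℤ ℤ ⟨orientedPinch o' p', continuous_orientedPinch o' p'⟩ n
        (homologicalOrientationOfSmooth o').fundamentalClass :=
  map_pinch_fundamentalClass_eq (mem_unitChart_source o p) (unitChart_self o p) hn (continuous_orientedPinch o p) _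
    (localClass_eq_unitChart o p) (mem_unitChart_source o' p') (unitChart_self o' p') (continuous_orientedPinch o' p') _
    (localClass_eq_unitChart o' p')

end Oriented

end SmoothPinch

end Literature.Geometry.Manifold
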